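import Literature.Analysis.FluidPDE.TorusVelocityMomentBalance
import HarnessLib

/-!
# The `L^{2m}` balance of classical Navier–Stokes solutions on `T^d` (RRS 2016, Exercise 11.4)

Analysis/FluidPDE proof file (theorems only). Power weights `Ψ(s) = sᵐ` in the weighted velocity
balance of `TorusVelocityMomentBalance`: along a classical solution of
`∂ₜu + (u·∇)u = νΔu − ∇p + f`, `div u = 0` on `T^d × [a, b]`,

`d/dt ∫|u|^{2m} = −ν (2m∫|u|^{2(m−1)}∑ₖ‖∂ₖu‖² + m(m−1)∫|u|^{2(m−2)}∑ₖ(∂ₖ|u|²)²) + 2m(m−1)∫ p|u|^{2(m−2)}∑ₖuₖ∂ₖ|u|² + 2m∫|u|^{2(m−1)}⟪u, f⟫`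

(`hasDerivWithinAt_integral_normSq_pow`), and — absorbing the pressure term into the second
viscous term pointwise, `2p uₖ∂ₖ|u|² ≤ ν(∂ₖ|u|²)² + p²uₖ²/ν` — the differential inequality of
Robinson–Rodrigo–Sadowski 2016, Exercise 11.4 (11.19) (`α = 2m`, there with `ν = 1`, `f = 0` and an
unspecified `c`; here `(1/α)U̇ + ν∫|u|^{α−2}|∇u|² ≤ ((α−2)/(4ν))∫p²|u|^{α−2} + ∫|u|^{α−2}⟪u,f⟫`):

`R ≤ −2mν ∫|u|^{2(m−1)}∑ₖ‖∂ₖu‖² + (m(m−1)/ν) ∫ p²|u|^{2(m−1)} + 2m ∫|u|^{2(m−1)}⟪u, f⟫`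

for every one-sided derivative `R` of `s ↦ ∫|u(s)|^{2m}` within `[a, b]` (`deriv_integral_normSq_pow_le`).

## References

* J. C. Robinson, J. L. Rodrigo, W. Sadowski, *The Three-Dimensional Navier–Stokes Equations*,
  CUP 2016, Ch. 11 Exercises 11.1, 11.3, 11.4 (eq. (11.19)) (held:
  book:robinson2016-three-dimensional-navier-stokes-equations-classical-theory, chunk 163).
  [RobinsonRodrigoSadowski2016]
-/

noncomputable section

open Set MeasureTheory Finset
open scoped ContDiff InnerProductSpace RealInnerProductSpace

namespace Literature.Analysis.FluidPDE

open Literature.Analysis.FunctionSpaces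

variable {d : Type*} [Fintype d] [DecidableEq d]

/-- **The `L^{2m}` balance** (Robinson–Rodrigo–Sadowski 2016, Exercise 11.4, exact form, `α = 2m`,
`m : ℕ`). Along a classical solution on `T^d × [a, b]` (`a < b`), for every `t ∈ [a, b]`,
`s ↦ ∫ (|u(s, x)|²)ᵐ` has the one-sided derivative
`−ν (2m∫|u|^{2(m−1)}∑ₖ‖∂ₖu‖² + m(m−1)∫|u|^{2(m−2)}∑ₖ(∂ₖ|u|²)²) + 2m(m−1)∫ p|u|^{2(m−2)}∑ₖuₖ∂ₖ|u|² + 2m∫|u|^{2(m−1)}⟪u, f⟫`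
within `[a, b]` (natural-number exponents: the `m(m−1)` terms vanish for `m ≤ 1`; `m = 1` is the
energy balance). [cite: RobinsonRodrigoSadowski2016, Ch. 11 Exercise 11.4 eq. (11.19)] -/
theorem _root_.Literature.Analysis.FunctionSpaces.Torus.IsClassicalNSSolutionOn.hasDerivWithinAt_integral_normSq_pow
    {a b ν : ℝ} {f u : ℝ → UnitAddTorus d → EuclideanSpace ℝ d} {p : ℝ → UnitAddTorus d → ℝ}
    (h : Torus.IsClassicalNSSolutionOn (Icc a b) ν f u p) (hab : a < b) (m : ℕ) {t : ℝ}
    (ht : t ∈ Icc a b) :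
    HasDerivWithinAt (fun s => ∫ x, (‖u s x‖ ^ 2) ^ m)
      (-(ν * (2 * m * (∫ x, (‖u t x‖ ^ 2) ^ (m - 1) * ∑ k, ‖Torus.partialDeriv k (u t) x‖ ^ 2) +
          m * (m - 1) * ∫ x, (‖u t x‖ ^ 2) ^ (m - 2) *
            ∑ k, Torus.partialDeriv k (fun y => ‖u t y‖ ^ 2) x ^ 2)) +
        2 * (m * (m - 1)) * (∫ x, p t x * ((‖u t x‖ ^ 2) ^ (m - 2) *
          ∑ k, u t x k * Torus.partialDeriv k (fun y => ‖u t y‖ ^ 2) x)) +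
        2 * m * ∫ x, (‖u t x‖ ^ 2) ^ (m - 1) * ⟪u t x, f t x⟫)
      (Icc a b) t := by
  have hΨ : ContDiffOn ℝ ∞ (fun s : ℝ => s ^ m) univ := (contDiff_id.pow m).contDiffOn
  have hD := h.hasDerivWithinAt_integral_comp_normSq hab isOpen_univ hΨ (fun _ _ _ => mem_univ _) ht
  have hd1 : ∀ y : ℝ, deriv (fun s : ℝ => s ^ m) y = m * y ^ (m - 1) := fun y => by simp
  have hd1' : deriv (fun s : ℝ => s ^ m) = fun y => (m : ℝ) * y ^ (m - 1) := funext hd1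
  have hd2 : ∀ y : ℝ, deriv (deriv (fun s : ℝ => s ^ m)) y = m * (m - 1) * y ^ (m - 2) := by
    intro y
    rw [hd1', deriv_const_mul _ (differentiableAt_pow _)]
    have : deriv (fun y : ℝ => y ^ (m - 1)) y = ((m - 1 : ℕ) : ℝ) * y ^ (m - 1 - 1) := by simp
    rw [this]
    rcases Nat.eq_zero_or_pos m with hm | hm
    · subst hm; simp
    · rw [Nat.cast_sub hm, show m - 1 - 1 = m - 2 by omega]
      push_cast
      ring
  simp only [hd1, hd2] at hD
  refine hD.congr_deriv ?_
  have e1 : ∫ x, (m : ℝ) * (‖u t x‖ ^ 2) ^ (m - 1) * ∑ k, ‖Torus.partialDeriv k (u t) x‖ ^ 2 =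
      m * ∫ x, (‖u t x‖ ^ 2) ^ (m - 1) * ∑ k, ‖Torus.partialDeriv k (u t) x‖ ^ 2 := by
    rw [← integral_const_mul]
    exact integral_congr_ae (ae_of_all _ fun x => by ring)
  have e2 : ∫ x, (m : ℝ) * (m - 1) * (‖u t x‖ ^ 2) ^ (m - 2) *
      ∑ k, Torus.partialDeriv k (fun y => ‖u t y‖ ^ 2) x ^ 2 =
      m * (m - 1) * ∫ x, (‖u t x‖ ^ 2) ^ (m - 2) *
        ∑ k, Torus.partialDeriv k (fun y => ‖u t y‖ ^ 2) x ^ 2 := by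
    rw [← integral_const_mul]
    exact integral_congr_ae (ae_of_all _ fun x => by ring)
  have e3 : ∫ x, p t x * ((m : ℝ) * (m - 1) * (‖u t x‖ ^ 2) ^ (m - 2) *
      ∑ k, u t x k * Torus.partialDeriv k (fun y => ‖u t y‖ ^ 2) x) =
      m * (m - 1) * ∫ x, p t x * ((‖u t x‖ ^ 2) ^ (m - 2) *
        ∑ k, u t x k * Torus.partialDeriv k (fun y => ‖u t y‖ ^ 2) x) := by
    rw [← integral_const_mul]
    exact integral_congr_ae (ae_of_all _ fun x => by ring)
  have e4 : ∫ x, (m : ℝ) * (‖u t x‖ ^ 2) ^ (m - 1) * ⟪u t x, f t x⟫ =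
      m * ∫ x, (‖u t x‖ ^ 2) ^ (m - 1) * ⟪u t x, f t x⟫ := by
    rw [← integral_const_mul]
    exact integral_congr_ae (ae_of_all _ fun x => by ring)
  rw [e1, e2, e3, e4]
  ring

/-- **The `L^{2m}` differential inequality of Robinson–Rodrigo–Sadowski 2016, Exercise 11.4 (11.19)**
(`α = 2m ≥ 2`; printed with `ν = 1`, `f = 0`: `(1/α) d/dt‖u‖_α^α + ½∫|u|^{α−2}|∇u|² ≤ c∫|p|²|u|^{α−2}`;
here with viscosity, forcing and the constant made explicit). Along a classical solution on
`T^d × [a, b]` with `ν > 0`, for every `m ≥ 1` and `t ∈ [a, b]`, every one-sided derivative value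
`R` of `s ↦ ∫ (|u(s)|²)ᵐ` within `[a, b]` satisfies
`R ≤ −2mν ∫|u|^{2(m−1)}∑ₖ‖∂ₖu‖² + (m(m−1)/ν) ∫ p²|u|^{2(m−1)} + 2m ∫|u|^{2(m−1)}⟪u, f⟫`
— the pressure term of the exact balance is absorbed pointwise into the nonpositive term
`−νm(m−1)∫|u|^{2(m−2)}∑ₖ(∂ₖ|u|²)²` via `2p uₖ∂ₖ|u|² ≤ ν(∂ₖ|u|²)² + p²uₖ²/ν`.
[cite: RobinsonRodrigoSadowski2016, Ch. 11 Exercise 11.4 eq. (11.19)] -/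
theorem _root_.Literature.Analysis.FunctionSpaces.Torus.IsClassicalNSSolutionOn.deriv_integral_normSq_pow_le
    {a b ν : ℝ} {f u : ℝ → UnitAddTorus d → EuclideanSpace ℝ d} {p : ℝ → UnitAddTorus d → ℝ}
    (h : Torus.IsClassicalNSSolutionOn (Icc a b) ν f u p) (hν : 0 < ν) (hab : a < b) {m : ℕ}
    (hm : 1 ≤ m) {t : ℝ} (ht : t ∈ Icc a b) {R : ℝ}
    (hR : HasDerivWithinAt (fun s => ∫ x, (‖u s x‖ ^ 2) ^ m) R (Icc a b) t) :
    R ≤ -(2 * m * ν * ∫ x, (‖u t x‖ ^ 2) ^ (m - 1) * ∑ k, ‖Torus.partialDeriv k (u t) x‖ ^ 2) +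
      m * (m - 1) / ν * (∫ x, p t x ^ 2 * (‖u t x‖ ^ 2) ^ (m - 1)) +
      2 * m * ∫ x, (‖u t x‖ ^ 2) ^ (m - 1) * ⟪u t x, f t x⟫ := by
  have hD := h.hasDerivWithinAt_integral_normSq_pow hab m ht
  have hU : UniqueDiffWithinAt ℝ (Icc a b) t := uniqueDiffOn_Icc hab t ht
  have hReq := (hR.derivWithin hU).symm.trans (hD.derivWithin hU)
  have hut : Torus.IsSmooth (u t) := h.smooth_velocity.isSmooth_slice ht
  have hpt : Torus.IsSmooth (p t) := h.smooth_pressure.isSmooth_slice ht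
  have hQ : Torus.IsSmooth (fun y => ‖u t y‖ ^ 2) := hut.norm_sq
  set Q : UnitAddTorus d → ℝ := fun y => ‖u t y‖ ^ 2 with hQdef
  have hmm : (0 : ℝ) ≤ (m : ℝ) * (m - 1) := by
    have : (1 : ℝ) ≤ m := by exact_mod_cast hm
    nlinarith
  -- pointwise absorption: `m(m-1)·2 p Q^{m-2} ∑ₖ uₖ ∂ₖQ ≤ m(m-1)·(ν Q^{m-2} ∑ₖ (∂ₖQ)² + p² Q^{m-1}/ν)`
  have hpw : ∀ x, (m : ℝ) * (m - 1) * (2 * (p t x * (Q x ^ (m - 2) *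
      ∑ k, u t x k * Torus.partialDeriv k Q x))) ≤
      (m : ℝ) * (m - 1) * (ν * (Q x ^ (m - 2) * ∑ k, Torus.partialDeriv k Q x ^ 2) +
        ν⁻¹ * (p t x ^ 2 * Q x ^ (m - 1))) := by
    intro x
    rcases Nat.lt_or_ge m 2 with hm2 | hm2
    · have h1 : m = 1 := by omega
      subst h1
      simp
    refine mul_le_mul_of_nonneg_left ?_ hmm
    have hnorm : Q x = ∑ k, u t x k ^ 2 := by
      simp only [hQdef]
      rw [EuclideanSpace.norm_sq_eq]
      exact Finset.sum_congr rfl fun k _ => by rw [Real.norm_eq_abs, sq_abs]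
    have hQm : Q x ^ (m - 1) = Q x ^ (m - 2) * ∑ k, u t x k ^ 2 := by
      rw [← hnorm, show m - 1 = (m - 2) + 1 by omega, pow_succ]
    rw [hQm]
    simp only [Finset.mul_sum]
    rw [← Finset.sum_add_distrib]
    refine Finset.sum_le_sum fun k _ => ?_
    have hQ0 : 0 ≤ Q x ^ (m - 2) := pow_nonneg (sq_nonneg _) _
    -- `2 P (u D) ≤ ν D² + P² u²/ν`
    have key : 2 * (p t x * (u t x k * Torus.partialDeriv k Q x)) ≤
        ν * Torus.partialDeriv k Q x ^ 2 + ν⁻¹ * (p t x ^ 2 * u t x k ^ 2) := by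
      rw [← sub_nonneg]
      have : ν * Torus.partialDeriv k Q x ^ 2 + ν⁻¹ * (p t x ^ 2 * u t x k ^ 2) -
          2 * (p t x * (u t x k * Torus.partialDeriv k Q x)) =
          (ν * Torus.partialDeriv k Q x - p t x * u t x k) ^ 2 / ν := by
        field_simp
        ring
      rw [this]
      exact div_nonneg (sq_nonneg _) hν.le
    nlinarith [mul_le_mul_of_nonneg_left key hQ0]
  -- integrate the pointwise inequality
  have sA : Torus.IsSmooth (fun x => p t x * (Q x ^ (m - 2) *
      ∑ k, u t x k * Torus.partialDeriv k Q x)) := by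
    have hs : ∀ k, Torus.IsSmooth (fun x => u t x k * Torus.partialDeriv k Q x) :=
      fun k => (hut.apply k).mul (hQ.partialDeriv k)
    have hsum : Torus.IsSmooth (fun x => ∑ k, u t x k * Torus.partialDeriv k Q x) := by
      have hl : Torus.lift (fun x => ∑ k, u t x k * Torus.partialDeriv k Q x) =
          fun z => ∑ k, Torus.lift (fun x => u t x k * Torus.partialDeriv k Q x) z := by
        funext z; simp only [Torus.lift_apply]
      unfold Torus.IsSmooth at hs ⊢
      rw [hl]; exact ContDiff.sum fun k _ => hs k
    exact hpt.mul ((hQ.pow (m - 2)).mul hsum)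
  have sB : Torus.IsSmooth (fun x => Q x ^ (m - 2) * ∑ k, Torus.partialDeriv k Q x ^ 2) := by
    have hs : ∀ k, Torus.IsSmooth (fun x => Torus.partialDeriv k Q x ^ 2) :=
      fun k => (hQ.partialDeriv k).pow 2
    have hsum : Torus.IsSmooth (fun x => ∑ k, Torus.partialDeriv k Q x ^ 2) := by
      have hl : Torus.lift (fun x => ∑ k, Torus.partialDeriv k Q x ^ 2) =
          fun z => ∑ k, Torus.lift (fun x => Torus.partialDeriv k Q x ^ 2) z := by
        funext z; simp only [Torus.lift_apply]
      unfold Torus.IsSmooth at hs ⊢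
      rw [hl]; exact ContDiff.sum fun k _ => hs k
    exact (hQ.pow (m - 2)).mul hsum
  have sC : Torus.IsSmooth (fun x => p t x ^ 2 * Q x ^ (m - 1)) := (hpt.pow 2).mul (hQ.pow (m - 1))
  have iA : Integrable (fun x => (m : ℝ) * (m - 1) * (2 * (p t x * (Q x ^ (m - 2) *
      ∑ k, u t x k * Torus.partialDeriv k Q x)))) := (sA.integrable.const_mul 2).const_mul _
  have iB : Integrable (fun x => ν * (Q x ^ (m - 2) * ∑ k, Torus.partialDeriv k Q x ^ 2)) :=
    sB.integrable.const_mul ν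
  have iC : Integrable (fun x => ν⁻¹ * (p t x ^ 2 * Q x ^ (m - 1))) := sC.integrable.const_mul ν⁻¹
  have iBC : Integrable (fun x => (m : ℝ) * (m - 1) * (ν * (Q x ^ (m - 2) *
      ∑ k, Torus.partialDeriv k Q x ^ 2) + ν⁻¹ * (p t x ^ 2 * Q x ^ (m - 1)))) :=
    (iB.add iC).const_mul _
  have hint := integral_mono iA iBC hpw
  simp only [integral_const_mul, integral_add iB iC] at hint
  have hdiv : (m : ℝ) * (m - 1) / ν * ∫ x, p t x ^ 2 * (‖u t x‖ ^ 2) ^ (m - 1) =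
      m * (m - 1) * (ν⁻¹ * ∫ x, p t x ^ 2 * Q x ^ (m - 1)) := by
    rw [div_eq_mul_inv]; ring
  rw [hReq, hdiv]
  nlinarith [hint, hν]

end Literature.Analysis.FluidPDE
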